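import Summits.Langlands.Langlands.Theses.RootDecomp1
import Summits.Langlands.Langlands.Theorems.IrreducibilityBySelfDualityIrreducibleOffSectorContragredient
import HarnessLib

/-!
# `RootDecomp1.DualTransport` — proof of the support item stmt-Langlands-29152

The item (support, rank 306 of `route-Langlands-RootDecomp1`, child of the `SemisimpleAvatar`
split; also wanted by `route-Langlands-CyclicDeinductionCarving`) says: **avatars dualise**.  For
`π`, `P` cuspidal (L-algebraic) on `GL_n/K` with `P` an a.e. contragredient of `π` at Satake level
(`t_{P,v} = t_{π,v}⁻¹` for almost all `v`), every semisimple `ℓ`-adic `ρ : Γ_K → GL_n(ℚ̄_ℓ)` that is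
Satake–Frobenius compatible with `(π, ι)` at almost all places yields a semisimple `ℓ`-adic
representation Satake–Frobenius compatible with `(P, ι)` at almost all places — namely the framed
dual `ρ^∨ = ᵗρ⁻¹` (`FramedRep.dual`).

* The Satake side is ALREADY IN THE TREE: `IrreducibleOffSector.eventually_satakeFrobCompatibleAt_dual`
  (`Theorems/IrreducibilityBySelfDualityIrreducibleOffSectorContragredient`): `ρ^∨` is an
  a.e.-compatible avatar of any Satake-level contragredient (Frobenius polynomials of `ρ^∨` have the
  inverse roots; `arithFrobPolyOfSatake ι q 1 α⁻¹`); the contragredient clause of the item is turned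
  into the `β = α⁻¹` form by uniqueness of Satake parameters (`hasSatakeParamAt_unique_holds`).
* The one new lemma is `DualTransport.isSemisimpleRepresentation_dual`: **the dual of a semisimple
  framed representation over a field is semisimple.**  Proof by orthogonality for the standard
  (non-degenerate, symmetric) pairing `⟨v, w⟩ = v ⬝ᵥ w` on `kⁿ`, which is invariant for `(ρ, ρ^∨)`:
  the orthogonal of a `ρ^∨`-stable subspace is `ρ`-stable (Literature
  `FramedRep.apply_mem_orthogonal_of_dual_stable`) and, as `(ρ^∨)^∨ = ρ`, the orthogonal of a
  `ρ`-stable subspace is `ρ^∨`-stable; so for a `ρ^∨`-subrepresentation `W`, a `ρ`-complement `U`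
  of `W^⊥` gives the `ρ^∨`-complement `U^⊥` of `W = W^⊥⊥`
  (`(N ⊔ L)^⊥ = N^⊥ ⊓ L^⊥`, `N^⊥⊥ = N`; Serre, *Linear representations of finite groups*, §1.4 (d)).

Main declaration: `Summit.Langlands.Langlands.Theorems.dualTransport_proof :
Summit.Langlands.Langlands.Theses.RootDecomp1.DualTransport` (the item's type BY NAME).
No Literature named fact is consumed; no definitions; nothing postulated.

References: J.-P. Serre, *Linear Representations of Finite Groups*, GTM 42 (1977), §1.4 (d)
[SerreLinearRepresentations1977]; J.-P. Serre, *Abelian ℓ-adic representations* (1968), Ch. I §2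
[SerreAbelianLadic1968]; H. Jacquet, J. Shalika, Amer. J. Math. 103 (1981), (1.2)
(`t_{π̃} = t_π⁻¹`) [JacquetShalikaAJM1981].
-/

noncomputable section

set_option linter.dupNamespace false

open scoped NumberField
open Filter IsDedekindDomain
open Literature.NumberTheory.Automorphic Literature.NumberTheory.GaloisRepresentations

namespace Summit.Langlands.Langlands.Theorems

namespace DualTransport

/-! ## 1. Orthogonals of a sup -/

section Orthogonal

variable {K V : Type*} [Field K] [AddCommGroup V] [Module K V]

/-- `(N ⊔ L)^⊥ = N^⊥ ⊓ L^⊥` for any bilinear form. [folklore] -/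
theorem orthogonal_sup_eq_inf (B : LinearMap.BilinForm K V) (N L : Submodule K V) :
    B.orthogonal (N ⊔ L) = B.orthogonal N ⊓ B.orthogonal L := by
  refine le_antisymm
    (le_inf (LinearMap.BilinForm.orthogonal_le le_sup_left)
      (LinearMap.BilinForm.orthogonal_le le_sup_right)) ?_
  intro m hm
  rw [Submodule.mem_inf, LinearMap.BilinForm.mem_orthogonal_iff,
    LinearMap.BilinForm.mem_orthogonal_iff] at hm
  rw [LinearMap.BilinForm.mem_orthogonal_iff]
  intro x hx
  obtain ⟨a, ha, b, hb, rfl⟩ := Submodule.mem_sup.1 hx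
  rw [map_add, LinearMap.add_apply, hm.1 a ha, hm.2 b hb, add_zero]

end Orthogonal

/-! ## 2. The dual of a semisimple framed representation is semisimple -/

section DualSemisimple

variable {G : Type*} [Group G] [TopologicalSpace G] {k : Type*} [Field k] [TopologicalSpace k]
  {n : ℕ}

/-- **The standard pairing is invariant for `(ρ^∨, ρ)`**: the orthogonal (for the dot product
`Matrix.toBilin' 1`) of a `ρ`-stable subspace `U ≤ kⁿ` is `ρ^∨`-stable — the Literature lemma
`FramedRep.apply_mem_orthogonal_of_dual_stable` for `ρ^∨`, as `(ρ^∨)^∨ = ρ`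
(`IrreducibleOffSector.dual_dual`). [cite: SerreLinearRepresentations1977, §1.4 (d)] -/
theorem dual_apply_mem_orthogonal_of_stable (ρ : FramedRep G k n)
    (U : Subrepresentation ρ.toRepresentation) (g : G) {v : Fin n → k}
    (hv : v ∈ (Matrix.toBilin' (1 : Matrix (Fin n) (Fin n) k)).orthogonal U.toSubmodule) :
    (FramedRep.dual ρ).toRepresentation g v ∈
      (Matrix.toBilin' (1 : Matrix (Fin n) (Fin n) k)).orthogonal U.toSubmodule := by
  let W : Subrepresentation (FramedRep.dual (FramedRep.dual ρ)).toRepresentation :=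
    ⟨U.toSubmodule, fun g' _ hv' => by
      rw [IrreducibleOffSector.dual_dual]
      exact U.apply_mem_toSubmodule g' hv'⟩
  exact (FramedRep.dual ρ).apply_mem_orthogonal_of_dual_stable W g hv

/-- **The dual of a semisimple representation is semisimple** (framed representations over a
field; Mathlib `Representation.IsSemisimpleRepresentation` = every subrepresentation has a
complement).  For the non-degenerate symmetric pairing `B = ⟨·,·⟩` on `kⁿ`: if `W` is `ρ^∨`-stable,
`W^⊥` is `ρ`-stable (`FramedRep.apply_mem_orthogonal_of_dual_stable`), so it has a `ρ`-stable
complement `U` (`W^⊥ ⊓ U = 0`, `W^⊥ ⊔ U = kⁿ`); then `U^⊥` is `ρ^∨`-stable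
(`dual_apply_mem_orthogonal_of_stable`) and is a complement of `W`:
`W ⊓ U^⊥ = W^⊥⊥ ⊓ U^⊥ = (W^⊥ ⊔ U)^⊥ = (kⁿ)^⊥ = 0` and
`W ⊔ U^⊥ = ((W ⊔ U^⊥)^⊥)^⊥ = (W^⊥ ⊓ U)^⊥ = 0^⊥ = kⁿ`
(`LinearMap.BilinForm.orthogonal_orthogonal`, `orthogonal_sup_eq_inf`).
[cite: SerreLinearRepresentations1977, §1.4 (d)] -/
theorem isSemisimpleRepresentation_dual (ρ : FramedRep G k n)
    (h : ρ.toRepresentation.IsSemisimpleRepresentation) :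
    (FramedRep.dual ρ).toRepresentation.IsSemisimpleRepresentation := by
  classical
  set B : LinearMap.BilinForm k (Fin n → k) := Matrix.toBilin' (1 : Matrix (Fin n) (Fin n) k)
    with hB
  have hBnd : B.Nondegenerate :=
    LinearMap.BilinForm.nondegenerate_toBilin'_of_det_ne_zero' _
      (by rw [Matrix.det_one]; exact one_ne_zero)
  have hBsymm : B.IsSymm := Matrix.isSymm_toBilin'_iff_isSymm.2 Matrix.isSymm_one
  have hBrefl : B.IsRefl := hBsymm.isRefl
  haveI : ComplementedLattice (Subrepresentation ρ.toRepresentation) := h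
  refine ⟨fun W => ?_⟩
  -- `W^⊥`, a `ρ`-subrepresentation
  let W' : Subrepresentation ρ.toRepresentation :=
    ⟨B.orthogonal W.toSubmodule, fun g _ hv => ρ.apply_mem_orthogonal_of_dual_stable W g hv⟩
  obtain ⟨U, hU⟩ := exists_isCompl W'
  -- `U^⊥`, a `ρ^∨`-subrepresentation: the complement of `W`
  let V : Subrepresentation (FramedRep.dual ρ).toRepresentation :=
    ⟨B.orthogonal U.toSubmodule, fun g _ hv => dual_apply_mem_orthogonal_of_stable ρ U g hv⟩
  have hWW : B.orthogonal (B.orthogonal W.toSubmodule) = W.toSubmodule :=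
    LinearMap.BilinForm.orthogonal_orthogonal hBnd hBrefl _
  have hUU : B.orthogonal (B.orthogonal U.toSubmodule) = U.toSubmodule :=
    LinearMap.BilinForm.orthogonal_orthogonal hBnd hBrefl _
  have h1 : B.orthogonal W.toSubmodule ⊓ U.toSubmodule = ⊥ :=
    congrArg Subrepresentation.toSubmodule hU.inf_eq_bot
  have h2 : B.orthogonal W.toSubmodule ⊔ U.toSubmodule = ⊤ :=
    congrArg Subrepresentation.toSubmodule hU.sup_eq_top
  refine ⟨V, isCompl_iff.2 ⟨disjoint_iff.2 ?_, codisjoint_iff.2 ?_⟩⟩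
  · apply Subrepresentation.toSubmodule_injective
    change W.toSubmodule ⊓ B.orthogonal U.toSubmodule = ⊥
    rw [← hWW, ← orthogonal_sup_eq_inf, h2, LinearMap.BilinForm.orthogonal_top_eq_bot hBnd]
  · apply Subrepresentation.toSubmodule_injective
    change W.toSubmodule ⊔ B.orthogonal U.toSubmodule = ⊤
    rw [← LinearMap.BilinForm.orthogonal_orthogonal hBnd hBrefl
        (W.toSubmodule ⊔ B.orthogonal U.toSubmodule),
      orthogonal_sup_eq_inf, hUU, h1, LinearMap.BilinForm.orthogonal_bot]

/-- `isSemisimpleRepresentation_dual` in the form consumed by `GaloisRep` statements: for a framed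
Galois representation over a topological field, `ρ` semisimple ⇒ `ρ^∨` semisimple
(`FramedGaloisRep.toGaloisRep`, `ContinuousRep.IsSemisimple`). [cite: SerreLinearRepresentations1977, §1.4 (d)] -/
theorem isSemisimple_toGaloisRep_dual {K : Type} [Field K] [IsTopologicalRing k]
    (ρ : FramedGaloisRep K k n) (h : ρ.toGaloisRep.IsSemisimple) :
    (FramedGaloisRep.toGaloisRep (FramedRep.dual ρ)).IsSemisimple :=
  isSemisimpleRepresentation_dual ρ h

end DualSemisimple

end DualTransport

/-! ## 3. The item -/

/-- **`RootDecomp1.DualTransport` (stmt-Langlands-29152): avatars dualise.**  Given `π`, `P`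
cuspidal on `GL_n/K` with `t_{P,v} = t_{π,v}⁻¹` for almost all `v`, and a semisimple
`ρ : Γ_K → GL_n(ℚ̄_ℓ)` Satake–Frobenius compatible with `(π, ι)` almost everywhere, the framed dual
`ρ^∨` is semisimple (`DualTransport.isSemisimple_toGaloisRep_dual`) and Satake–Frobenius compatible
with `(P, ι)` almost everywhere (`IrreducibleOffSector.eventually_satakeFrobCompatibleAt_dual`, the
contragredient clause being put in the form `β = α⁻¹` by `hasSatakeParamAt_unique_holds`).  The
L-algebraicity hypotheses are carried, not used.
[cite: SerreLinearRepresentations1977, §1.4 (d)] [cite: JacquetShalikaAJM1981, (1.2)] -/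
theorem dualTransport_proof : Summit.Langlands.Langlands.Theses.RootDecomp1.DualTransport := by
  intro K _ _ n hcpt hn π P hπ hP hcontra ℓ _ ι ρ hss hρ
  refine ⟨FramedRep.dual ρ, DualTransport.isSemisimple_toGaloisRep_dual ρ hss, ?_⟩
  refine IrreducibleOffSector.eventually_satakeFrobCompatibleAt_dual ι π.1 P.1 ?_ hρ
  filter_upwards [hcontra] with v hv α β hα hβ
  exact P.1.hasSatakeParamAt_unique_holds hβ (hv α hα)

end Summit.Langlands.Langlands.Theorems
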